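import Summits.QuantumFields.YangMills.Theorems.UnitScaleTiltProp7IterLinStructure
import HarnessLib

/-!
# Route `UnitScaleTilt`, crux K1 «MinimiserStabilityRegPr» (stmt-QuantumFields-19200) — route-R E′ (A′)-comb, COMB-FLAT-COERCIVITY, sub-lemma (I3′) «δQ-SLICE»,
# PLAN B (w4 g8 2026-08-29 05:54Z «(iii) := PLAN B P1–P4»), FILE P3 «TELESCOPE»: **THE COMB-MINUS-SYM DEFECT IS A ONE-STEP RECURSION** —
# the difference of two `k`-fold products of one-step averagings `σ_j = t_j − d_{j+1}∘λ_j` (tube minus coarse gradient of a leg functional, gradient-intertwining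
# `σ_j∘d_j = d_{j+1}∘ρ_j`) splits as `Πσ_{<j} − Πγ_{<j} = A_j + d_jΦ_j` with the SCALE-`L` recursions `A_{j+1} = t_j A_j + e_j(G_j)`, `Φ_{j+1} = ρ_jΦ_j − λ_j A_j`,
# `e_j := σ_j − γ_j` the one-step defect — no `ℓ`-scale object anywhere

Cell `ym3-torus`, width seat `ym3-torus-px22` (gen 5; LOCATE `LOCATE-I3-ONESTEP-px22g5.md` e50e2a2b, 19200 evidence).  THEOREMS ONLY (0 `def`, 0 `sorry`);
`--supports stmt-QuantumFields-19200 --as helper`, count-neutral.  YM₃ on T³ is a ladder rung (R3), not the Clay problem; nothing here claims (I3′), COMB-FLAT-COERCIVITY,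
A6ᶜ, `hN06`, hcoS, E′, EX, the crux, d = 4 or the mass gap.

WHY.  By ✓`Prop7CombFlatProjectorTransport.coercive_laplaceAc_one_of_sliceBound_basePt` (px13) and w4's FILE B′ `sliceBound_basePt_of_sqBound`, COMB-FLAT-COERCIVITY at the
flat member follows from ONE row: `Σ_c‖QTw 1 X′ c − QTwS 1 X c‖² ≤ C(L)·ℓ·Σ_p‖curl 1 X p‖²` (`X′ = X ∘ translate(−x₀)`, `ℓ = L^{K−n}`), with `C(L)` INDEPENDENT OF `K, n`.
Both operators are `k`-fold PRODUCTS of ONE-STEP maps on the torus levels (`Q⁽ᵏ⁾ = linAvg^k`, ✓`Prop7AvgLinearisation`; the comb side = cornered tube minus the coarse gradient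
of the comb legs, px21's P2), so their difference TELESCOPES into one-step defects `e_j` living at scale `L`; this file is the ALGEBRA of that telescope, in the form P4
(px6) consumes: a pair of recursively defined families `(A_j, Φ_j)` — "tube part" and "spine potential" — with `Πσ_{<j} − Πγ_{<j} = A_j + d_jΦ_j`.  Every constant of the
eventual estimate is then a ONE-STEP (scale-`L`) constant by construction.

WHAT IS PROVED (ns `…Theorems.Prop7DefectTelescope`).
* §1 ABSTRACT (dependent families `B S : ℕ → Type*` of additive groups; `σ γ : B j →+ B (j+1)`, `d : S j →+ B j`, arbitrary `t, λ, ρ`):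
  ★★ `prod_eq_tube_sub_grad` — if `σ_j y = t_j y − d_{j+1}(λ_j y)` and `σ_j(d_jφ) = d_{j+1}(ρ_jφ)` then `Πσ_{<j} x = T_j x − d_j(Ψ_j x)` for the families
  `T_{j+1} = t_jT_j`, `Ψ_{j+1} = ρ_jΨ_j + λ_j(T_jx)` (the abstract form of ✓`linFamily_eq_sub_comb` ∕ ✓`exists_iterLin_eq_bondAvgIter_sub_grad`);
  ★ `defect_step` — `σS − γG = σ(S − G) + (σ − γ)G`;
  ★★★ `prod_sub_prod_eq_A_add_grad` — **THE (A, Φ) SPLIT**: `Πσ_{<j} x − Πγ_{<j} x = A_j x + d_j(Φ_j x)` with `A_0 = 0`, `Φ_0 = 0`,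
  `A_{j+1} = t_j(A_j) + (σ_j − γ_j)(Πγ_{<j} x)`, `Φ_{j+1} = ρ_j(Φ_j) − λ_j(A_j)`;
  ★★ `defect_on_prod_eq_defect_on_tube` — if moreover `γ_j = t′_j − d_{j+1}∘φ_j` intertwines gradients THE SAME WAY (`γ_j(d_jφ) = d_{j+1}(ρ_jφ)`: common base child) then
  `(σ_j − γ_j)(Πγ_{<j} x) = (σ_j − γ_j)(T′_j x)` — the defect only ever sees the TUBE tower.
* §2 THE SYM SIDE ON THE TORUS (`P : Params`, matrix-valued fields): the hypotheses of §1 DISCHARGED for `σ_j := linAvg` with `t_j = L•bondAvg`, `λ_j = combMean`,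
  `ρ_j = (· ∘ emb)`, `d_jφ(b) = φ(b₊) − φ(b₋)` (lit ✓`linAvg_eq_bondAvg_sub_grad_combMean`, ✓`linAvg_grad`): ★★ `linFamily_sub_prod_eq_A_add_grad` — for ANY one-step family `γ_j`
  with `γ_j(d_jφ) = d_{j+1}(φ ∘ emb)` and its product family `G`, `Q⁽ʲ⁾x − G_j x = A_j x + dΦ_j x` with the concrete recursions.
HONEST SCOPE.  Algebra of finite sums; the member knit (`X′`, `QTw 1`, `QTwS 1`, px21's comb one-step `γ_j`) is §3 of this file's sequel once P2 (px21 g6) fixes `γ_j`'s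
letters; the ESTIMATE is P1 (w4) + P4 (px6).  Nothing of (I3′) is concluded here.  Rung R3, not Clay; YM gap NOT proved.

References: T. Bałaban, CMP 98 (1985) 17–51 [Balaban1985Averaging] ((11) p.18, (62) p.28, (124)–(127) pp.36–37, (160) p.42); CMP 95 (1984) 17–40 [Balaban1984PropagatorsI]
((1.18)–(1.20) p.20); CMP 99 (1985) 389–434 [Balaban1985BackgroundPropagators] ((3.14) p.393, Thm 3.11 p.416).
-/

set_option autoImplicit false

noncomputable section

open scoped BigOperators

namespace Summit.QuantumFields.YangMills.Theorems.Prop7DefectTelescope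

/-! ## §1 The abstract one-step telescope -/

section Abstract

variable {B S : ℕ → Type*} [∀ j, AddCommGroup (B j)] [∀ j, AddCommGroup (S j)]
variable (σ : ∀ j, B j →+ B (j + 1)) (d : ∀ j, S j →+ B j)
  (t : ∀ j, B j → B (j + 1)) (lam : ∀ j, B j → S (j + 1)) (ρ : ∀ j, S j → S (j + 1))
  (hσ : ∀ (j : ℕ) (y : B j), σ j y = t j y - d (j + 1) (lam j y))
  (hσd : ∀ (j : ℕ) (φ : S j), σ j (d j φ) = d (j + 1) (ρ j φ))

include hσ hσd in
/-- ★★ **A PRODUCT OF «TUBE MINUS COARSE GRADIENT OF LEGS» STEPS IS «TUBE PRODUCT MINUS ONE COARSE GRADIENT»**: if every one-step map is `σ_j = t_j − d_{j+1}∘λ_j` and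
maps gradients to gradients by `σ_j(d_jφ) = d_{j+1}(ρ_jφ)`, then the product family `S_j = σ_{j−1}∘⋯∘σ_0` satisfies `S_j x = T_j x − d_j(Ψ_j x)` where `T` is the tube
product (`T_{j+1} = t_jT_j`) and `Ψ` the ACCUMULATED POTENTIAL (`Ψ_0 = 0`, `Ψ_{j+1} = ρ_jΨ_j + λ_j(T_j x)`).  Abstract form of ✓`Prop7AvgLinearisation.exists_iterLin_eq_bondAvgIter_sub_grad`
∕ ✓`Prop8ChartHInvComb.linFamily_eq_sub_comb` (sym side) and of ✓`Prop7FlatFrameResponse.fderiv_frameTw_one_apply` (comb side). [cite: Balaban1984PropagatorsI, (1.18)-(1.20) p.20; Balaban1985Averaging, (124)-(127) pp.36-37] -/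
theorem prod_eq_tube_sub_grad
    (Sf : ∀ j, B 0 → B j) (hS0 : ∀ x, Sf 0 x = x) (hSs : ∀ (j : ℕ) (x : B 0), Sf (j + 1) x = σ j (Sf j x))
    (T : ∀ j, B 0 → B j) (hT0 : ∀ x, T 0 x = x) (hTs : ∀ (j : ℕ) (x : B 0), T (j + 1) x = t j (T j x))
    (Ψ : ∀ j, B 0 → S j) (hΨ0 : ∀ x, Ψ 0 x = 0) (hΨs : ∀ (j : ℕ) (x : B 0), Ψ (j + 1) x = ρ j (Ψ j x) + lam j (T j x)) :
    ∀ (j : ℕ) (x : B 0), Sf j x = T j x - d j (Ψ j x) := by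
  intro j
  induction j with
  | zero => intro x; rw [hS0, hT0, hΨ0, map_zero, sub_zero]
  | succ j ih =>
    intro x
    rw [hSs, ih, map_sub, hσ, hσd, hTs, hΨs, map_add]
    abel

/-- ★ **THE ONE-STEP DEFECT IDENTITY**: `σ(S) − γ(G) = σ(S − G) + (σ(G) − γ(G))`. [folklore] -/
theorem defect_step (γ : ∀ j, B j →+ B (j + 1)) (j : ℕ) (S G : B j) :
    σ j S - γ j G = σ j (S - G) + (σ j G - γ j G) := by
  rw [map_sub]; abel

include hσ hσd in
/-- ★★★ **THE (A, Φ) SPLIT OF THE DIFFERENCE OF TWO ONE-STEP PRODUCTS.**  Let `σ_j = t_j − d_{j+1}∘λ_j` intertwine gradients (`σ_j∘d_j = d_{j+1}∘ρ_j`) and let `γ_j` be ANY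
other additive one-step family, `S = Πσ`, `G = Πγ` their products.  If the families `A` ("tube part") and `Φ` ("spine potential") obey `A_0 = 0`, `Φ_0 = 0`,
`A_{j+1} x = t_j(A_j x) + (σ_j − γ_j)(G_j x)`, `Φ_{j+1} x = ρ_j(Φ_j x) − λ_j(A_j x)`, then **`S_j x − G_j x = A_j x + d_j(Φ_j x)`** for every `j`.  (One induction:
`σS − γG = σ(A + dΦ) + (σ−γ)G = tA − dλA + dρΦ + (σ−γ)G`.)  Hence the defect between the two towers is driven ONLY by the one-step defects `e_j := σ_j − γ_j`
evaluated on the `γ`-tower, transported upward by tubes `t_j` and leg functionals `λ_j` — every object at scale `L`. [cite: Balaban1985Averaging, (124)-(127) pp.36-37, (160) p.42] -/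
theorem prod_sub_prod_eq_A_add_grad (γ : ∀ j, B j →+ B (j + 1))
    (Sf : ∀ j, B 0 → B j) (hS0 : ∀ x, Sf 0 x = x) (hSs : ∀ (j : ℕ) (x : B 0), Sf (j + 1) x = σ j (Sf j x))
    (G : ∀ j, B 0 → B j) (hG0 : ∀ x, G 0 x = x) (hGs : ∀ (j : ℕ) (x : B 0), G (j + 1) x = γ j (G j x))
    (A : ∀ j, B 0 → B j) (hA0 : ∀ x, A 0 x = 0) (hAs : ∀ (j : ℕ) (x : B 0), A (j + 1) x = t j (A j x) + (σ j (G j x) - γ j (G j x)))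
    (Φ : ∀ j, B 0 → S j) (hΦ0 : ∀ x, Φ 0 x = 0) (hΦs : ∀ (j : ℕ) (x : B 0), Φ (j + 1) x = ρ j (Φ j x) - lam j (A j x)) :
    ∀ (j : ℕ) (x : B 0), Sf j x - G j x = A j x + d j (Φ j x) := by
  intro j
  induction j with
  | zero => intro x; rw [hS0, hG0, hA0, hΦ0, map_zero, sub_self, add_zero]
  | succ j ih =>
    intro x
    rw [hSs, hGs, defect_step σ γ j, ih, map_add, hσ, hσd, hAs, hΦs, map_sub]
    abel

/-- ★★ **THE ONE-STEP DEFECT ONLY SEES THE TUBE TOWER.**  If the second family is also of the form `γ_j = t′_j − d_{j+1}∘φ_j` and intertwines gradients THE SAME WAY as `σ_j`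
(`γ_j(d_jψ) = d_{j+1}(ρ_jψ)` — on the torus: both leg systems issue from the same base child, so both sample at `emb`), then on the `γ`-product `G_j x = T′_j x − d_j(Ψ′_j x)`
(`prod_eq_tube_sub_grad` for `γ`) the gradient part is invisible to `e_j = σ_j − γ_j`: `σ_j(G_j x) − γ_j(G_j x) = σ_j(T′_j x) − γ_j(T′_j x)`. [cite: Balaban1985Averaging, (11) p.18] -/
theorem defect_on_prod_eq_defect_on_tube (hσd : ∀ (j : ℕ) (φ : S j), σ j (d j φ) = d (j + 1) (ρ j φ)) (γ : ∀ j, B j →+ B (j + 1))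
    (t' : ∀ j, B j → B (j + 1)) (φ : ∀ j, B j → S (j + 1))
    (hγ : ∀ (j : ℕ) (y : B j), γ j y = t' j y - d (j + 1) (φ j y))
    (hγd : ∀ (j : ℕ) (ψ : S j), γ j (d j ψ) = d (j + 1) (ρ j ψ))
    (G : ∀ j, B 0 → B j) (hG0 : ∀ x, G 0 x = x) (hGs : ∀ (j : ℕ) (x : B 0), G (j + 1) x = γ j (G j x))
    (T' : ∀ j, B 0 → B j) (hT0 : ∀ x, T' 0 x = x) (hTs : ∀ (j : ℕ) (x : B 0), T' (j + 1) x = t' j (T' j x))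
    (Ψ' : ∀ j, B 0 → S j) (hΨ0 : ∀ x, Ψ' 0 x = 0) (hΨs : ∀ (j : ℕ) (x : B 0), Ψ' (j + 1) x = ρ j (Ψ' j x) + φ j (T' j x))
    (j : ℕ) (x : B 0) :
    σ j (G j x) - γ j (G j x) = σ j (T' j x) - γ j (T' j x) := by
  rw [prod_eq_tube_sub_grad γ d t' φ ρ hγ hγd G hG0 hGs T' hT0 hTs Ψ' hΨ0 hΨs j x, map_sub, map_sub, hσd, hγd]
  abel

include hσ hσd in
/-- ★★★ **THE (A, Φ) SPLIT WITH THE DEFECT READ ON THE TUBE TOWER** (`prod_sub_prod_eq_A_add_grad` ∘ `defect_on_prod_eq_defect_on_tube`): under the hypotheses of both, the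
families with `A_{j+1} x = t_j(A_j x) + (σ_j − γ_j)(T′_j x)` (defect on the γ-TUBE tower `T′`) and `Φ_{j+1} x = ρ_j(Φ_j x) − λ_j(A_j x)` satisfy `Πσ_{<j} x − Πγ_{<j} x = A_j x + d_j(Φ_j x)`.
[cite: Balaban1985Averaging, (124)-(127) pp.36-37, (160) p.42; Balaban1984PropagatorsI, (1.18) p.20] -/
theorem prod_sub_prod_eq_A_add_grad_tube (γ : ∀ j, B j →+ B (j + 1))
    (t' : ∀ j, B j → B (j + 1)) (φ : ∀ j, B j → S (j + 1))
    (hγ : ∀ (j : ℕ) (y : B j), γ j y = t' j y - d (j + 1) (φ j y))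
    (hγd : ∀ (j : ℕ) (ψ : S j), γ j (d j ψ) = d (j + 1) (ρ j ψ))
    (Sf : ∀ j, B 0 → B j) (hS0 : ∀ x, Sf 0 x = x) (hSs : ∀ (j : ℕ) (x : B 0), Sf (j + 1) x = σ j (Sf j x))
    (G : ∀ j, B 0 → B j) (hG0 : ∀ x, G 0 x = x) (hGs : ∀ (j : ℕ) (x : B 0), G (j + 1) x = γ j (G j x))
    (T' : ∀ j, B 0 → B j) (hT0 : ∀ x, T' 0 x = x) (hTs : ∀ (j : ℕ) (x : B 0), T' (j + 1) x = t' j (T' j x))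
    (A : ∀ j, B 0 → B j) (hA0 : ∀ x, A 0 x = 0) (hAs : ∀ (j : ℕ) (x : B 0), A (j + 1) x = t j (A j x) + (σ j (T' j x) - γ j (T' j x)))
    (Φ : ∀ j, B 0 → S j) (hΦ0 : ∀ x, Φ 0 x = 0) (hΦs : ∀ (j : ℕ) (x : B 0), Φ (j + 1) x = ρ j (Φ j x) - lam j (A j x)) :
    ∀ (j : ℕ) (x : B 0), Sf j x - G j x = A j x + d j (Φ j x) := by
  -- the accumulated comb potential of the γ-tower (zero content: defined by recursion)
  let Ψ' : ∀ j, B 0 → S j := fun j => Nat.rec (motive := fun j => B 0 → S j) (fun _ => 0) (fun j Ψj x => ρ j (Ψj x) + φ j (T' j x)) j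
  have hΨ0 : ∀ x, Ψ' 0 x = 0 := fun _ => rfl
  have hΨs : ∀ (j : ℕ) (x : B 0), Ψ' (j + 1) x = ρ j (Ψ' j x) + φ j (T' j x) := fun _ _ => rfl
  refine prod_sub_prod_eq_A_add_grad σ d t lam ρ hσ hσd γ Sf hS0 hSs G hG0 hGs A hA0 (fun j x => ?_) Φ hΦ0 hΦs
  rw [hAs, defect_on_prod_eq_defect_on_tube σ d ρ hσd γ t' φ hγ hγd G hG0 hGs T' hT0 hTs Ψ' hΨ0 hΨs j x]

end Abstract

/-! ## §2 The sym side on the torus: `σ_j := linAvg` discharges the hypotheses of §1 -/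

section Torus

open Literature.MathematicalPhysics.QuantumFieldTheory.Balaban1983to89
open T4Continuum BlockAveraging BlockAveragingEMLLinearised LatticeFieldCalculus
open Summit.QuantumFields.YangMills.Theorems.Prop7LinAvgOnto (linAvg_add)

variable {P : Params} {n : Type*} [Fintype n] [DecidableEq n] [Nonempty n]

omit [Fintype n] [DecidableEq n] [Nonempty n] in
/-- The coarse gradient `φ ↦ (b ↦ φ(b₊) − φ(b₋))` is additive. [folklore] -/
theorem grad_add {j : ℕ} (φ ψ : Site P j → Matrix n n ℂ) :
    (fun b : PBond P j => (φ + ψ) b.tgt - (φ + ψ) b.src) = (fun b : PBond P j => φ b.tgt - φ b.src) + fun b : PBond P j => ψ b.tgt - ψ b.src := by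
  funext b; simp only [Pi.add_apply]; abel

omit [Fintype n] [DecidableEq n] [Nonempty n] in
/-- ★★ **THE (A, Φ) SPLIT ON THE TORUS, SYM SIDE CONCRETE.**  Let `Q⁽ʲ⁾` be the iterated linearised (0.4)-average (`Q⁽⁰⁾ = id`, `Q⁽ʲ⁺¹⁾ = linAvg ∘ Q⁽ʲ⁾`, ✓`exists_linFamily`) and let
`γ_j` be ANY additive one-step family of the form «tube `t′_j` minus the coarse gradient of a leg functional `φ_j`» which maps a fine pure gauge `dψ` to the coarse pure gauge of
`ψ ∘ emb` (as `linAvg` does, lit ✓`linAvg_grad` — i.e. its legs issue from the centre child `emb`), with product family `G` and tube product `T′`.  If `A_0 = 0`, `Φ_0 = 0`,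
`A_{j+1}(x)(c) = L·(Q A_j(x))(c) + [linAvg (T′_j x) c − γ_j (T′_j x) c]` (✓`bondAvg` = print's `Q` of (1.11)) and `Φ_{j+1}(x)(y) = Φ_j(x)(emb y) − λ̄_{A_j(x)}(y)` (lit ✓`combMean`), then
**`Q⁽ʲ⁾x(c) − G_j x(c) = A_j x(c) + (Φ_j x(c₊) − Φ_j x(c₋))`**.  (§1 with `σ_j := linAvg = L·Q − dλ̄`, lit ✓`linAvg_eq_bondAvg_sub_grad_combMean`, and `linAvg(dψ) = d(ψ∘emb)`, lit ✓`linAvg_grad`.)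
This is the form P4 consumes: the one-step defect `e_j = linAvg − γ_j` enters only through `e_j(T′_j x)`, transported by ONE tube step and ONE comb-mean step per level.
[cite: Balaban1985Averaging, (124)-(127) pp.36-37, (11) p.18, (62) p.28; Balaban1984PropagatorsI, (1.11) p.19, (1.18) p.20] -/
theorem linFamily_sub_prod_eq_A_add_grad
    (Q : (i : ℕ) → (PBond P 0 → Matrix n n ℂ) → PBond P i → Matrix n n ℂ)
    (hQ0 : ∀ Y, Q 0 Y = Y) (hQs : ∀ (i : ℕ) (Y : PBond P 0 → Matrix n n ℂ) (c : PBond P (i + 1)), Q (i + 1) Y c = linAvg (Q i Y) c)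
    (γf : (j : ℕ) → (PBond P j → Matrix n n ℂ) → PBond P (j + 1) → Matrix n n ℂ)
    (hγadd : ∀ (j : ℕ) (Y Y' : PBond P j → Matrix n n ℂ) (c : PBond P (j + 1)), γf j (Y + Y') c = γf j Y c + γf j Y' c)
    (t' : (j : ℕ) → (PBond P j → Matrix n n ℂ) → PBond P (j + 1) → Matrix n n ℂ)
    (φf : (j : ℕ) → (PBond P j → Matrix n n ℂ) → Site P (j + 1) → Matrix n n ℂ)
    (hγ : ∀ (j : ℕ) (Y : PBond P j → Matrix n n ℂ) (c : PBond P (j + 1)), γf j Y c = t' j Y c - (φf j Y c.tgt - φf j Y c.src))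
    (hγd : ∀ (j : ℕ) (ψ : Site P j → Matrix n n ℂ) (c : PBond P (j + 1)), γf j (fun b => ψ b.tgt - ψ b.src) c = ψ (emb c.tgt) - ψ (emb c.src))
    (G : (j : ℕ) → (PBond P 0 → Matrix n n ℂ) → PBond P j → Matrix n n ℂ)
    (hG0 : ∀ x, G 0 x = x) (hGs : ∀ (j : ℕ) (x : PBond P 0 → Matrix n n ℂ) (c : PBond P (j + 1)), G (j + 1) x c = γf j (G j x) c)
    (T' : (j : ℕ) → (PBond P 0 → Matrix n n ℂ) → PBond P j → Matrix n n ℂ)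
    (hT0 : ∀ x, T' 0 x = x) (hTs : ∀ (j : ℕ) (x : PBond P 0 → Matrix n n ℂ) (c : PBond P (j + 1)), T' (j + 1) x c = t' j (T' j x) c)
    (A : (j : ℕ) → (PBond P 0 → Matrix n n ℂ) → PBond P j → Matrix n n ℂ)
    (hA0 : ∀ x b, A 0 x b = 0)
    (hAs : ∀ (j : ℕ) (x : PBond P 0 → Matrix n n ℂ) (c : PBond P (j + 1)),
      A (j + 1) x c = ((P.L : ℕ) : ℂ) • bondAvg (A j x) c + (linAvg (T' j x) c - γf j (T' j x) c))
    (Φ : (j : ℕ) → (PBond P 0 → Matrix n n ℂ) → Site P j → Matrix n n ℂ)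
    (hΦ0 : ∀ x y, Φ 0 x y = 0)
    (hΦs : ∀ (j : ℕ) (x : PBond P 0 → Matrix n n ℂ) (y : Site P (j + 1)), Φ (j + 1) x y = Φ j x (emb y) - combMean (A j x) y)
    (j : ℕ) (x : PBond P 0 → Matrix n n ℂ) (c : PBond P j) :
    Q j x c - G j x c = A j x c + (Φ j x c.tgt - Φ j x c.src) := by
  -- §1's data: `σ_j := linAvg`, `d_j ψ := (b ↦ ψ b₊ − ψ b₋)` as additive maps; `t_j := L·Q`, `λ_j := combMean`, `ρ_j := (· ∘ emb)`
  let σ : ∀ j, (PBond P j → Matrix n n ℂ) →+ (PBond P (j + 1) → Matrix n n ℂ) := fun j =>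
    AddMonoidHom.mk' (fun Y => fun c => linAvg Y c) (fun Y Y' => funext fun c => linAvg_add Y Y' c)
  let γ : ∀ j, (PBond P j → Matrix n n ℂ) →+ (PBond P (j + 1) → Matrix n n ℂ) := fun j =>
    AddMonoidHom.mk' (fun Y => fun c => γf j Y c) (fun Y Y' => funext fun c => hγadd j Y Y' c)
  let d : ∀ j, (Site P j → Matrix n n ℂ) →+ (PBond P j → Matrix n n ℂ) := fun j =>
    AddMonoidHom.mk' (fun ψ => fun b : PBond P j => ψ b.tgt - ψ b.src) (fun ψ ψ' => grad_add ψ ψ')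
  have key := prod_sub_prod_eq_A_add_grad_tube (B := fun j => PBond P j → Matrix n n ℂ) (S := fun j => Site P j → Matrix n n ℂ) σ d
    (fun j Y c => ((P.L : ℕ) : ℂ) • bondAvg Y c) (fun j Y y => combMean Y y) (fun j ψ y => ψ (emb y))
    (fun j Y => funext fun c => linAvg_eq_bondAvg_sub_grad_combMean Y c) (fun j ψ => funext fun c => linAvg_grad ψ c)
    γ t' φf (fun j Y => funext fun c => hγ j Y c) (fun j ψ => funext fun c => hγd j ψ c)
    Q hQ0 (fun j x => funext fun c => hQs j x c) G hG0 (fun j x => funext fun c => hGs j x c) T' hT0 (fun j x => funext fun c => hTs j x c)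
    A (fun x => funext fun b => hA0 x b) (fun j x => funext fun c => hAs j x c) Φ (fun x => funext fun y => hΦ0 x y) (fun j x => funext fun y => hΦs j x y) j x
  exact congrFun key c

end Torus

end Summit.QuantumFields.YangMills.Theorems.Prop7DefectTelescope

end
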